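import Summits.AtomisticToContinuum.HydrodynamicLimit.Theorems.InformationPercolationEngineChaosClosesEulerReductionPathwise
import HarnessLib

/-!
# Kinetic reduction (crux `ChaosClosesEuler`, stmt-AtomisticToContinuum-15141, line `Sketch`,
# stub `stub_kineticReduction`) — helper: the union bound at one `N`

WHAT. At a fixed particle number and mollification radius, with every tolerance fixed: if the twelve bad events
(energy level, density cap, collision tail, collision-rate deviations on the grid windows and on the whole horizon,
weak stress isotropy, collisional pressure and clamped local second law deviations on the grids, the three initial
deviations, and the null complement of the good set) have small probability, then so has the deviation event of the
time-averaged `L¹` distance: outside them the deterministic core `reduction_pathwise` applies (`reduction_events`).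

No named fact is invoked.
-/

noncomputable section

namespace Summit.AtomisticToContinuum.HydrodynamicLimit.Theorems.ChaosClosesEulerReduction

open scoped BigOperators Topology Classical MeasureTheory InnerProductSpace ENNReal
open Filter Set MeasureTheory Function
open Literature.MathematicalPhysics.KineticTheory
open Literature.Analysis.FluidPDE
open Literature.Analysis.FunctionSpaces
open Summit.AtomisticToContinuum.HydrodynamicLimit.Theorems.LocalSecondLawNegative
open Summit.AtomisticToContinuum.HydrodynamicLimit.Theorems.LocalSecondLawLedger
open Summit.AtomisticToContinuum.HydrodynamicLimit.Theorems.LocalSecondLawLedger.L (Mmom)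

variable {N : ℕ}

/-! ## §1 Twelve bad events -/

/-- **Twelve bad events.** An event avoided by every point outside eleven events of probability `≤ δ₁` and one null
event has probability `≤ 11 δ₁ ≤ δ'`. [folklore] -/
theorem measure_le_of_forall_notMem12 {Ω : Type*} [MeasurableSpace Ω] (P : Measure Ω)
    {S1 S2 S3 S4 S5 S6 S7 S8 S9 S10 S11 S12 D : Set Ω} {δ₁ δ' : ℝ} (hδ₁ : 0 ≤ δ₁)
    (h1 : P S1 ≤ ENNReal.ofReal δ₁)
    (h2 : P S2 ≤ ENNReal.ofReal δ₁)
    (h3 : P S3 ≤ ENNReal.ofReal δ₁)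
    (h4 : P S4 ≤ ENNReal.ofReal δ₁)
    (h5 : P S5 ≤ ENNReal.ofReal δ₁)
    (h6 : P S6 ≤ ENNReal.ofReal δ₁)
    (h7 : P S7 ≤ ENNReal.ofReal δ₁)
    (h8 : P S8 ≤ ENNReal.ofReal δ₁)
    (h9 : P S9 ≤ ENNReal.ofReal δ₁)
    (h10 : P S10 ≤ ENNReal.ofReal δ₁)
    (h11 : P S11 ≤ ENNReal.ofReal δ₁)
    (h12 : P S12 = 0) (hδ' : 11 * δ₁ ≤ δ')
    (hD : ∀ z, z ∉ S1 → z ∉ S2 → z ∉ S3 → z ∉ S4 → z ∉ S5 → z ∉ S6 → z ∉ S7 → z ∉ S8 → z ∉ S9 → z ∉ S10 → z ∉ S11 → z ∉ S12 → z ∉ D) :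
    P D ≤ ENNReal.ofReal δ' := by
  have h := measure_le_of_avoid P (S := ![S1, S2, S3, S4, S5, S6, S7, S8, S9, S10, S11, S12])
    (b := ![δ₁, δ₁, δ₁, δ₁, δ₁, δ₁, δ₁, δ₁, δ₁, δ₁, δ₁, 0]) (fun i => by fin_cases i <;> first | exact hδ₁ | exact le_rfl) (fun i => ?_) (D := D)
    (fun z hz => hD z (hz 0) (hz 1) (hz 2) (hz 3) (hz 4) (hz 5) (hz 6) (hz 7) (hz 8) (hz 9) (hz 10) (hz 11))
  · refine h.trans (ENNReal.ofReal_le_ofReal ?_)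
    simp only [Fin.sum_univ_succ, Fin.sum_univ_zero, Matrix.cons_val_zero, Matrix.cons_val_succ]
    linarith
  · fin_cases i
    · exact h1
    · exact h2
    · exact h3
    · exact h4
    · exact h5
    · exact h6
    · exact h7
    · exact h8
    · exact h9
    · exact h10
    · exact h11
    · exact (le_of_eq h12).trans bot_le

/-- **Registered sub-goal `stub_reductionFrameA` (helper of `stub_kineticReduction`): the energy level event read as a
bound of the kinetic energy per particle along the orbit.** [folklore] -/
theorem stub_reductionFrameA : ∀ {N : ℕ} {σ : ℝ} (Φ : HardSphereFlow (Torus.geometry (Fin 3)) (hsDiameter σ N) (N + 1)) {z : Config (N + 1) (Fin 3) T3}, z ∈ Φ.good → ∀ {KE : ℝ}, ¬ KE < ((N : ℝ) + 1)⁻¹ * configEnergy (Φ.flow 0 z) → ke z ≤ KE := by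
  intro N σ Φ z hz KE h
  rw [not_lt, Φ.configEnergy_flow hz 0] at h
  rw [rr_ke_eq]; push_cast; exact h

/-! ## §2 The union bound at one `N` -/

set_option maxHeartbeats 3200000 in
/-- **THE UNION BOUND AT ONE `N`.** See the module docstring. [folklore] -/
theorem reduction_events {σ : ℝ} (hσ : 0 < σ) (hσ2 : σ < 2⁻¹)
    (Φ : HardSphereFlow (Torus.geometry (Fin 3)) (hsDiameter σ N) (N + 1)) (P : Measure (Phase N))
    {r : ℝ} (hr : 0 < r) (hr2 : r < 1 / 2)
    {T : ℝ} {ρ θ : ℝ → T3 → ℝ} {u : ℝ → T3 → V3} (hE : IsHardSphereEulerSolution σ T ρ u θ)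
    {t Δ e : ℝ} {m : ℕ} (ht0 : 0 ≤ t) (hΔ : 0 < Δ) (he : 0 < e) (hT : t + (m + 1 : ℕ) * Δ + e < T)
    -- the shell at this `σ`, horizon `t + (m+1)Δ`, window `Δ`, defect `δ`
    {η₁ a₁ b₁ ε' δ : ℝ} {χe f : ℝ → ℝ} (hχ : ContinuousOn χe (Ioi 0)) {B : ℝ} (hB0 : 0 ≤ B) (hB : ∀ a, 0 < a → |χe a| ≤ B)
    (hband : ∀ a, 0 < a → a * σ ^ 3 ≤ η₁ → χe a = hsCompressibility (a * σ ^ 3))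
    (hfband : ∀ a, 0 < a → a * σ ^ 3 ≤ η₁ → f a = hsExcessFreeEnergy (a * σ ^ 3))
    (hFc : ContinuousOn (fun c => hsExcessFreeEnergy (min c η₁) + deriv hsExcessFreeEnergy η₁ * max (c - η₁) 0) (Ici 0))
    (hSH : ∀ V : ℝ → T3 → ℝ × V3 × ℝ, Measurable (Function.uncurry V) →
      (∃ C : ℝ, ∀ s x, |(V s x).1| ≤ C ∧ ‖(V s x).2.1‖ ≤ C ∧ |(V s x).2.2| ≤ C) →
      (∀ s x, 0 ≤ (V s x).1) → (∀ s x, ‖(V s x).2.1‖ ^ 2 ≤ 2 * (V s x).1 * (V s x).2.2) →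
      let θo : ℝ × V3 × ℝ → ℝ := fun U => 2 / 3 * (U.2.2 / U.1 - ‖U.2.1‖ ^ 2 / (2 * U.1 ^ 2))
      let pV : ℝ × V3 × ℝ → ℝ := fun U => U.1 * θo U * χe U.1
      let Zs : ℝ × V3 × ℝ → ℝ := fun U => max a₁ (min (3 / 2 * Real.log (θo U) - Real.log U.1 - f U.1) b₁)
      let Etot : ℝ → T3 → ℝ := fun s x => totalEnergyDensity (ρ s x) (u s x) (θ s x)
      let cut : ℝ → ℝ → ℝ := fun τ₀ s => Real.smoothTransition ((τ₀ + Δ - s) / Δ)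
      (∀ φ : ℝ → T3 → ℝ, Torus.IsSmoothSpaceTimeOn Set.univ φ → ∀ τ ∈ Set.Icc 0 (t + (m + 1 : ℕ) * Δ), (∫ x, φ τ x * (V τ x).1) - ∫ x, φ 0 x * (V 0 x).1 = ∫ s in Set.Icc 0 τ, ∫ x, (deriv (fun s' => φ s' x) s * (V s x).1 + ∑ k : Fin 3, (V s x).2.1 k * Torus.partialDeriv k (φ s) x)) →
      (∀ τ ∈ Set.Icc 0 (t + (m + 1 : ℕ) * Δ), |(∫ x, ⟪u τ x, (V τ x).2.1⟫_ℝ) - (∫ x, ⟪u 0 x, (V 0 x).2.1⟫_ℝ) - ∫ s in Set.Icc 0 τ, ∫ x, (⟪Torus.timeDerivWithin (Set.Ico 0 T) u s x, (V s x).2.1⟫_ℝ + ∑ i : Fin 3, ∑ j : Fin 3, Torus.partialDeriv j (fun y => u s y i) x * ((V s x).2.1 i * (V s x).2.1 j / (V s x).1 + if i = j then pV (V s x) else 0))| ≤ δ) →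
      (∀ τ₀ ∈ Set.Icc 0 (t + (m + 1 : ℕ) * Δ - Δ), (∫ s in Set.Icc 0 (t + (m + 1 : ℕ) * Δ), ∫ x, ((V s x).1 * Zs (V s x) * Torus.timeDerivWithin (Set.Ico 0 T) (fun s' y => θ s' y * cut τ₀ s') s x + Zs (V s x) * ⟪(V s x).2.1, Torus.gradient (fun y => θ s y * cut τ₀ s) x⟫_ℝ)) + ∫ x, (V 0 x).1 * Zs (V 0 x) * (θ 0 x * cut τ₀ 0) ≤ δ) →
      (∀ τ ∈ Set.Icc 0 (t + (m + 1 : ℕ) * Δ), ∫ x, (V τ x).2.2 ≤ (∫ x, (V 0 x).2.2) + δ) →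
      (∀ x, |(V 0 x).1 - ρ 0 x| ≤ δ ∧ ‖(V 0 x).2.1 - ρ 0 x • u 0 x‖ ≤ δ ∧ |(V 0 x).2.2 - Etot 0 x| ≤ δ) →
      ∀ τ₀ ∈ Set.Icc 0 (t + (m + 1 : ℕ) * Δ - Δ), ∫ s in Set.Icc τ₀ (τ₀ + Δ), ∫ x, (|(V s x).1 - ρ s x| + ‖(V s x).2.1 - ρ s x • u s x‖ + |(V s x).2.2 - Etot s x|) ≤ ε' * Δ)
    (hδ : 0 ≤ δ)
    -- guard, cap, cut-off levels
    {η₀g ηcap ηg ηg2 : ℝ} (hη₀g0 : 0 ≤ η₀g) (hguard : ∀ s ∈ Ico 0 T, ∀ x, ρ s x * σ ^ 3 < η₀g) (hcap0 : 0 ≤ ηcap)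
    (hη₁cap : η₀g + ηcap ≤ η₁) (hg12 : ηg < ηg2) (hη₀gg : η₀g ≤ ηg / 2) (hcapg : ηcap ≤ ηg / 2)
    {KE : ℝ} (hKE0 : 0 ≤ KE) {Lv η₂ : ℝ} {CY : ℝ} (hCY0 : 0 ≤ CY) (hCY : ∀ a ∈ Set.Icc 0 ηg2, |deriv hsExcessFreeEnergy a| ≤ CY)
    {n : ℕ} (hn : 1 ≤ n) (hne : (t + (m + 1 : ℕ) * Δ) / n ≤ e) {η₃ : ℝ}
    -- the classical velocity: bounds, shift moduli, space modulus of the gradient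
    {Cu : ℝ} (hCu : 0 ≤ Cu) (hut : ∀ s ∈ Icc 0 (t + (m + 1 : ℕ) * Δ + e), ∀ x, ‖Torus.timeDerivWithin (Ico 0 T) u s x‖ ≤ Cu)
    (hD : ∀ s ∈ Icc 0 (t + (m + 1 : ℕ) * Δ + e), ∀ x, ∀ i j : Fin 3, |Torus.partialDeriv j (fun y => u s y i) x| ≤ Cu)
    {ω : ℝ} (hω : 0 ≤ ω) (hωu : ∀ s ∈ Icc 0 (t + (m + 1 : ℕ) * Δ), ∀ x, ‖u (s + e) x - u s x‖ ≤ ω)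
    (hωt : ∀ s ∈ Icc 0 (t + (m + 1 : ℕ) * Δ), ∀ x,
      ‖Torus.timeDerivWithin (Ico 0 T) u (s + e) x - Torus.timeDerivWithin (Ico 0 T) u s x‖ ≤ ω)
    (hωD : ∀ s ∈ Icc 0 (t + (m + 1 : ℕ) * Δ), ∀ x, ∀ i j : Fin 3,
      |Torus.partialDeriv j (fun y => u (s + e) y i) x - Torus.partialDeriv j (fun y => u s y i) x| ≤ ω)
    {ωx : ℝ} (hωx0 : 0 ≤ ωx) (hωx : ∀ s ∈ Icc 0 (t + (m + 1 : ℕ) * Δ), ∀ x y : T3, Torus.euclidDist x y < r + hsDiameter σ N →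
      ∀ i j : Fin 3, |Torus.partialDeriv j (fun y => u (s + e) y i) x - Torus.partialDeriv j (fun y' => u (s + e) y' i) y| ≤ ωx)
    (hθ : Torus.IsSmoothSpaceTimeOn (Ico 0 T) θ)
    {Cθ : ℝ} (hCθ : 0 ≤ Cθ) (hθb : ∀ s ∈ Icc 0 (t + (m + 1 : ℕ) * Δ + e), ∀ x, |θ s x| ≤ Cθ)
    (hθt : ∀ s ∈ Icc 0 (t + (m + 1 : ℕ) * Δ + e), ∀ x, |Torus.timeDerivWithin (Ico 0 T) θ s x| ≤ Cθ)
    (hθx : ∀ s ∈ Icc 0 (t + (m + 1 : ℕ) * Δ + e), ∀ x, ‖Torus.gradient (θ s) x‖ ≤ Cθ)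
    (hωθ : ∀ s ∈ Icc 0 (t + (m + 1 : ℕ) * Δ), ∀ x, |θ (s + e) x - θ s x| ≤ ω)
    (hωθt : ∀ s ∈ Icc 0 (t + (m + 1 : ℕ) * Δ), ∀ x,
      |Torus.timeDerivWithin (Ico 0 T) θ (s + e) x - Torus.timeDerivWithin (Ico 0 T) θ s x| ≤ ω)
    (hωθx : ∀ s ∈ Icc 0 (t + (m + 1 : ℕ) * Δ), ∀ x, ‖Torus.gradient (θ (s + e)) x - Torus.gradient (θ s) x‖ ≤ ω)
    {C : ℝ} (hC1 : ∀ x, |deriv Real.smoothTransition x| ≤ C) (hC2 : ∀ x, |deriv (deriv Real.smoothTransition) x| ≤ C)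
    {n' : ℕ} (hn' : 1 ≤ n') {ηW ηP ηL : ℝ}
    -- the two smallness conditions
    (hS2 : ηW + ηP / 2 + 3 / 2 * Cu * hsDiameter σ N * (2 * (N + 1 : ℝ)⁻¹ + 8 * KE) +
        3 / 2 * ωx * ((1 + max Lv 0) * (η₃ + σ ^ 3 * (3 * (t + (m + 1 : ℕ) * Δ) * (3 / (2 * Real.pi) * CY) *
          (2 * Real.pi * (η₀g / σ ^ 3 + ηcap) * (1 / 2 + KE)))) + η₂) +
        (t + (m + 1 : ℕ) * Δ) / n * ((60 * Cu + 2 * Cu * (1 + B)) * KE) +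
        3 / 2 * Cu * ((1 + max Lv 0) * (η₃ + σ ^ 3 * (3 * ((t + (m + 1 : ℕ) * Δ) / n) * (3 / (2 * Real.pi) * CY) *
          (2 * Real.pi * (η₀g / σ ^ 3 + ηcap) * (1 / 2 + KE)))) + η₂) +
        ω * ((1 + 2 * KE) + (t + (m + 1 : ℕ) * Δ) * ((7 + 2 * B) * KE + 1 / 2)) ≤ δ)
    (hS3 : ηL + ((t + (m + 1 : ℕ) * Δ) * (max |a₁| |b₁| * (Cθ * (C / Δ * ((t + (m + 1 : ℕ) * Δ - Δ) / n'))) * KE +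
          (max |a₁| |b₁| * (Cθ * (C / Δ * ((t + (m + 1 : ℕ) * Δ - Δ) / n')) + Cθ * (C / Δ ^ 2 * ((t + (m + 1 : ℕ) * Δ - Δ) / n'))) +
            max |a₁| |b₁| * (Cθ * (C / Δ * ((t + (m + 1 : ℕ) * Δ - Δ) / n'))) / 2)) +
        max |a₁| |b₁| * Cθ * (C / Δ * ((t + (m + 1 : ℕ) * Δ - Δ) / n'))) +
      ((t + (m + 1 : ℕ) * Δ) * (max |a₁| |b₁| * ω * KE + (max |a₁| |b₁| * (ω + ω * (C / Δ)) + max |a₁| |b₁| * ω / 2)) +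
        max |a₁| |b₁| * ω) ≤ δ)
    {δ₁ δ' thr : ℝ} (hδ₁ : 0 ≤ δ₁) (hδ' : 11 * δ₁ ≤ δ') (hthr : ε' * ((m + 1 : ℕ) * Δ) < thr)
    (hgood : P Φ.goodᶜ = 0)
    (evE : P {z | KE < ((N : ℝ) + 1)⁻¹ * configEnergy (Φ.flow 0 z)} ≤ ENNReal.ofReal δ₁)
    (evCap : P {z | ∃ s ∈ Set.Icc 0 (t + (m + 1 : ℕ) * Δ + e), ∃ x : T3, ρ s x + ηcap < rhoC r (Φ.flow s z) x} ≤ ENNReal.ofReal δ₁)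
    (evTail : P {z | η₂ < hsDiameter σ N / ((N : ℝ) + 1) *
      (∑ᶠ (s : ℝ) (_ : s ∈ collisionTimes (Torus.geometry (Fin 3)) (hsDiameter σ N) (fun s => Φ.flow s z) ∩
        Set.Icc 0 (t + (m + 1 : ℕ) * Δ + e)), ∑ i : Fin (N + 1), ∑ j : Fin (N + 1),
        (if i ≠ j ∧ ‖(Torus.geometry (Fin 3)).sepVec (Φ.flow s z i).1 (Φ.flow s z j).1‖ = hsDiameter σ N then
          (if Lv < ‖(Φ.flow s z i).2‖ ^ 2 + ‖(Φ.flow s z j).2‖ ^ 2 then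
            1 + ‖(Φ.flow s z i).2‖ ^ 2 + ‖(Φ.flow s z j).2‖ ^ 2 else 0) else 0))} ≤ ENNReal.ofReal δ₁)
    (evCr : P (⋃ g : Fin (n + 1), {z | η₃ < |hsDiameter σ N / ((N : ℝ) + 1) *
      (∑ᶠ (s : ℝ) (_ : s ∈ collisionTimes (Torus.geometry (Fin 3)) (hsDiameter σ N) (fun s => Φ.flow s z) ∩
        Set.Icc 0 (t + (m + 1 : ℕ) * Δ + e)), ∑ i : Fin (N + 1), ∑ j : Fin (N + 1),
        (if i ≠ j ∧ ‖(Torus.geometry (Fin 3)).sepVec (Φ.flow s z i).1 (Φ.flow s z j).1‖ = hsDiameter σ N then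
          max 0 (min 1 (min ((s - (g : ℝ) * ((t + (m + 1 : ℕ) * Δ) / n) + ((t + (m + 1 : ℕ) * Δ) / n)) / ((t + (m + 1 : ℕ) * Δ) / n))
            (((g : ℝ) * ((t + (m + 1 : ℕ) * Δ) / n) + 2 * ((t + (m + 1 : ℕ) * Δ) / n) - s) / ((t + (m + 1 : ℕ) * Δ) / n)))) *
            max 0 (min 1 ((ηg2 - σ ^ 3 * DensityCapNegative.mollDensity r (Φ.flow s z) (Φ.flow s z i).1) / (ηg2 - ηg)))
          else 0)) -
      σ ^ 3 * ∫ s in Set.Icc (0 : ℝ) (t + (m + 1 : ℕ) * Δ + e), ∫ x : T3,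
        max 0 (min 1 (min ((s - (g : ℝ) * ((t + (m + 1 : ℕ) * Δ) / n) + ((t + (m + 1 : ℕ) * Δ) / n)) / ((t + (m + 1 : ℕ) * Δ) / n))
            (((g : ℝ) * ((t + (m + 1 : ℕ) * Δ) / n) + 2 * ((t + (m + 1 : ℕ) * Δ) / n) - s) / ((t + (m + 1 : ℕ) * Δ) / n)))) *
          max 0 (min 1 ((ηg2 - σ ^ 3 * DensityCapNegative.mollDensity r (Φ.flow s z) x) / (ηg2 - ηg))) *
          (3 / (2 * Real.pi) * deriv hsExcessFreeEnergy (σ ^ 3 * DensityCapNegative.mollDensity r (Φ.flow s z) x)) *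
          ∫ p, cone r p.1.1 x * cone r p.2.1 x * (Real.pi * ‖p.1.2 - p.2.2‖)
            ∂((empiricalMeasure (Φ.flow s z)).prod (empiricalMeasure (Φ.flow s z)))|}) ≤ ENNReal.ofReal δ₁)
    (evCr0 : P {z | η₃ < |hsDiameter σ N / ((N : ℝ) + 1) *
      (∑ᶠ (s : ℝ) (_ : s ∈ collisionTimes (Torus.geometry (Fin 3)) (hsDiameter σ N) (fun s => Φ.flow s z) ∩
        Set.Icc 0 (t + (m + 1 : ℕ) * Δ + e)), ∑ i : Fin (N + 1), ∑ j : Fin (N + 1),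
        (if i ≠ j ∧ ‖(Torus.geometry (Fin 3)).sepVec (Φ.flow s z i).1 (Φ.flow s z j).1‖ = hsDiameter σ N then
          max 0 (min 1 (min ((s - 0 + (t + (m + 1 : ℕ) * Δ)) / (t + (m + 1 : ℕ) * Δ))
            ((0 + 2 * (t + (m + 1 : ℕ) * Δ) - s) / (t + (m + 1 : ℕ) * Δ)))) *
            max 0 (min 1 ((ηg2 - σ ^ 3 * DensityCapNegative.mollDensity r (Φ.flow s z) (Φ.flow s z i).1) / (ηg2 - ηg)))
          else 0)) -
      σ ^ 3 * ∫ s in Set.Icc (0 : ℝ) (t + (m + 1 : ℕ) * Δ + e), ∫ x : T3,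
        max 0 (min 1 (min ((s - 0 + (t + (m + 1 : ℕ) * Δ)) / (t + (m + 1 : ℕ) * Δ))
            ((0 + 2 * (t + (m + 1 : ℕ) * Δ) - s) / (t + (m + 1 : ℕ) * Δ)))) *
          max 0 (min 1 ((ηg2 - σ ^ 3 * DensityCapNegative.mollDensity r (Φ.flow s z) x) / (ηg2 - ηg))) *
          (3 / (2 * Real.pi) * deriv hsExcessFreeEnergy (σ ^ 3 * DensityCapNegative.mollDensity r (Φ.flow s z) x)) *
          ∫ p, cone r p.1.1 x * cone r p.2.1 x * (Real.pi * ‖p.1.2 - p.2.2‖)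
            ∂((empiricalMeasure (Φ.flow s z)).prod (empiricalMeasure (Φ.flow s z)))|} ≤ ENNReal.ofReal δ₁)
    (evW : P (⋃ g : Fin (n + 1), {z | ηW < |∫ s in Icc 0 ((g : ℝ) * ((t + (m + 1 : ℕ) * Δ) / n)), ∫ x,
      max 0 (min 1 ((ηg2 - σ ^ 3 * rhoC r (Φ.flow s z) x) / (ηg2 - ηg))) *
      ∑ j : Fin 3, ∑ k : Fin 3, (Torus.partialDeriv k (fun y => u (max 0 (min s (t + (m + 1 : ℕ) * Δ)) + e) y j) x -
        (if j = k then (∑ l : Fin 3, Torus.partialDeriv l (fun y => u (max 0 (min s (t + (m + 1 : ℕ) * Δ)) + e) y l) x) / 3 else 0)) *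
        (Mmom r (Φ.flow s z) x j k - momC r (Φ.flow s z) x j * momC r (Φ.flow s z) x k / rhoC r (Φ.flow s z) x)|}) ≤ ENNReal.ofReal δ₁)
    (evP : P (⋃ g : Fin (n + 1), {z | ηP < |hsDiameter σ N / (N + 1 : ℝ) *
      (∑ᶠ (s : ℝ) (_ : s ∈ collisionTimes (Torus.geometry (Fin 3)) (hsDiameter σ N) (fun s => Φ.flow s z) ∩
        Set.Icc 0 ((g : ℝ) * ((t + (m + 1 : ℕ) * Δ) / n))), ∑ i : Fin (N + 1), ∑ j : Fin (N + 1),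
        (if i ≠ j ∧ ‖(Torus.geometry (Fin 3)).sepVec (Φ.flow s z i).1 (Φ.flow s z j).1‖ = hsDiameter σ N then
          max 0 (min 1 ((ηg2 - σ ^ 3 * rhoC r (Φ.flow s z) (Φ.flow s z i).1) / (ηg2 - ηg))) *
          |⟪(vin (Φ.flow s z) i j).1 - (vin (Φ.flow s z) i j).2, nrm (hsDiameter σ N) (Φ.flow s z) i j⟫_ℝ| *
          ∑ k : Fin 3, ∑ l : Fin 3, (Torus.partialDeriv l (fun y => u (max 0 (min s (t + (m + 1 : ℕ) * Δ)) + e) y k) (Φ.flow s z i).1 +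
            Torus.partialDeriv k (fun y => u (max 0 (min s (t + (m + 1 : ℕ) * Δ)) + e) y l) (Φ.flow s z i).1) / 2 *
            (nrm (hsDiameter σ N) (Φ.flow s z) i j k * nrm (hsDiameter σ N) (Φ.flow s z) i j l) else 0)) -
      2 * ∫ s in Icc 0 ((g : ℝ) * ((t + (m + 1 : ℕ) * Δ) / n)), ∫ x,
        max 0 (min 1 ((ηg2 - σ ^ 3 * rhoC r (Φ.flow s z) x) / (ηg2 - ηg))) *
        (hsPressure σ (rhoC r (Φ.flow s z) x) (thetaC r (Φ.flow s z) x) - rhoC r (Φ.flow s z) x * thetaC r (Φ.flow s z) x) *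
        ∑ k : Fin 3, (Torus.partialDeriv k (fun y => u (max 0 (min s (t + (m + 1 : ℕ) * Δ)) + e) y k) x +
          Torus.partialDeriv k (fun y => u (max 0 (min s (t + (m + 1 : ℕ) * Δ)) + e) y k) x) / 2|}) ≤ ENNReal.ofReal δ₁)
    (evL : P (⋃ g : Fin (n' + 1), {z | ηL < (∫ s in Icc 0 (t + (m + 1 : ℕ) * Δ + e), ∫ x,
      (rhoC r (Φ.flow s z) x * max a₁ (min (3 / 2 * Real.log (thetaC r (Φ.flow s z) x) - Real.log (rhoC r (Φ.flow s z) x) -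
        (hsExcessFreeEnergy (min (rhoC r (Φ.flow s z) x * σ ^ 3) η₁) +
          deriv hsExcessFreeEnergy η₁ * max (rhoC r (Φ.flow s z) x * σ ^ 3 - η₁) 0)) b₁) *
        Torus.timeDeriv (fun s' y => Real.smoothTransition ((s' + e / 2) / (e / 4)) * θ (s' + e) y *
          Real.smoothTransition (((g : ℝ) * (((t + (m + 1 : ℕ) * Δ) - Δ) / n') + Δ - s') / Δ)) s x +
      max a₁ (min (3 / 2 * Real.log (thetaC r (Φ.flow s z) x) - Real.log (rhoC r (Φ.flow s z) x) -
        (hsExcessFreeEnergy (min (rhoC r (Φ.flow s z) x * σ ^ 3) η₁) +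
          deriv hsExcessFreeEnergy η₁ * max (rhoC r (Φ.flow s z) x * σ ^ 3 - η₁) 0)) b₁) *
        ⟪momC r (Φ.flow s z) x, Torus.gradient (fun y => Real.smoothTransition ((s + e / 2) / (e / 4)) * θ (s + e) y *
          Real.smoothTransition (((g : ℝ) * (((t + (m + 1 : ℕ) * Δ) - Δ) / n') + Δ - s) / Δ)) x⟫_ℝ)) +
      ∫ x, rhoC r (Φ.flow 0 z) x * max a₁ (min (3 / 2 * Real.log (thetaC r (Φ.flow 0 z) x) - Real.log (rhoC r (Φ.flow 0 z) x) -
        (hsExcessFreeEnergy (min (rhoC r (Φ.flow 0 z) x * σ ^ 3) η₁) +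
          deriv hsExcessFreeEnergy η₁ * max (rhoC r (Φ.flow 0 z) x * σ ^ 3 - η₁) 0)) b₁) *
        (Real.smoothTransition (((0 : ℝ) + e / 2) / (e / 4)) * θ (0 + e) x *
          Real.smoothTransition (((g : ℝ) * (((t + (m + 1 : ℕ) * Δ) - Δ) / n') + Δ - 0) / Δ))}) ≤ ENNReal.ofReal δ₁)
    (evI1 : P {z | ∃ x, δ < |rhoC r (Φ.flow 0 z) x - ρ 0 x|} ≤ ENNReal.ofReal δ₁)
    (evI2 : P {z | ∃ x, δ < ‖momC r (Φ.flow 0 z) x - ρ 0 x • u 0 x‖} ≤ ENNReal.ofReal δ₁)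
    (evI3 : P {z | ∃ x, δ < |kinC r (Φ.flow 0 z) x - totalEnergyDensity (ρ 0 x) (u 0 x) (θ 0 x)|} ≤ ENNReal.ofReal δ₁) :
    P {z | thr < ∫ s in Icc t (t + (m + 1 : ℕ) * Δ),
      ((∫ x, |empiricalDensityField (Φ.flow s z) (fun y => cone r y x) - ρ s x|) +
        (∫ x, ‖empiricalMomentumField (Φ.flow s z) (fun y => cone r y x) - ρ s x • u s x‖) +
        ∫ x, |empiricalEnergyField (Φ.flow s z) (fun y => cone r y x) - totalEnergyDensity (ρ s x) (u s x) (θ s x)|)} ≤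
      ENNReal.ofReal δ' := by
  refine measure_le_of_forall_notMem12 P hδ₁ evE evCap evTail evCr evCr0 evW evP evL evI1 evI2 evI3 hgood hδ'
    fun z nE nCap nTail nCr nCr0 nW nP nL nI1 nI2 nI3 ngood hzD => ?_
  simp only [Set.mem_setOf_eq, Set.mem_compl_iff, not_not, Set.mem_iUnion, not_exists, not_lt, not_and] at nE nCap nTail nCr nCr0 nW nP nL nI1 nI2 nI3 ngood hzD
  have hKE : ke z ≤ KE := stub_reductionFrameA Φ ngood (not_lt.2 nE)
  have key := reduction_pathwise hσ hσ2 Φ ngood hr hr2 hE ht0 hΔ he hT hχ hB0 hB hband hfband hFc hSH hδ hη₀g0 hguard hcap0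
    (fun s hs x => nCap s hs x) hη₁cap hg12 hη₀gg hcapg hKE0 hKE nTail hCY0 hCY hn hne nCr nCr0 hCu hut hD hω hωu hωt hωD
    hωx0 hωx nW nP hθ hCθ hθb hθt hθx hωθ hωθt hωθx hC1 hC2 hn' nL nI1 nI2 nI3 hS2 hS3
  linarith

end Summit.AtomisticToContinuum.HydrodynamicLimit.Theorems.ChaosClosesEulerReduction

end
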